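import Literature.IUT.HodgeTheaters.PiAvatarNFCuspLabels
import HarnessLib

/-!
# `Aut(𝒟^⊚) → Aut(LabCusp(𝒟^⊚))` and the character `Aut(𝒟^⊚) → 𝔽_l^⋇` at the genuine initial Θ-data ([IUTchI] Def 4.1 (v),
# Ex 4.3 (i)) — the packaging of `PiAvatarNFCuspLabels` on `Aut(𝒟^⊚) = N(Π_{C̲_K})/Π_{C̲_K}` (post-freeze additive D13, NFKIT-INSTANCE-MAP
# row NFK-3 sequel; 4 small defs + proofs; not a cone member)

S. Mochizuki, *Inter-universal Teichmüller theory I*, kurims manuscript (May 2020), Def 4.1 (v) p. 97 l. 33–37 («the set of label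
classes of cusps `LabCusp(†𝒟^⊚)` of `†𝒟^⊚`, which admits a natural `𝔽_l^⋇`-torsor structure»), Ex 4.3 (i) pp. 98–99
(«`Aut_ε̲(C̲_K) ⊆ Aut(C̲_K) ≅ Aut(𝒟^⊚)` … for the subgroup of elements which fix the cusp `ε̲`»; «natural isomorphisms …
`Aut(C̲_K)/Aut_ε̲(C̲_K) ⥲ 𝔽_l^⋇`») ([IUTchI] Ex 4.3 (i) p.99) [claim: Mochizuki2012, status: disputed] (D-0012 claim key, series status
DISPUTED — definitions + kernel theorems over abc-iut-L5-t2's REAL `InitialThetaData`, abc-iut-L5-t1's `CuspGalois`, under abc-iut-L5-t4's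
binder `hS : D.CuspClassesNormaliserStable`; nothing of the series is asserted, no side is taken on [IUTchIII] Cor. 3.12).

WHAT IS BUILT (abc-iut-L5-t3, NF-side kit; t4's descent pattern `gLabAutModel`/`toFlStarGlobal` through `OrbitCat.autEquiv D.PiCund`):
* `labActNFHom : ↥N(Π_{C̲_K}) →* Perm (LabCusp(𝒟^⊚))` (the permutations `labActNF` of `PiAvatarNFCuspLabels`), killing `Π_{C̲_K}`
  (`subgroupOf_le_ker_labActNFHom`), hence **`gLabNFAutModel : Aut(𝒟^⊚) →* Perm (LabCusp(𝒟^⊚))`** — the NF-kit slot `gLabNFMap` on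
  automorphisms of the model `𝒟^⊚ = D.gBaseObj` (convention forced by `autEquiv`, as for t4: on `xΠ ↦ xmΠ` the value is `(labActNF m)⁻¹`);
* `toFlStarNFOnNormalizer : ↥N(Π_{C̲_K}) →* 𝔽_l^⋇` (class of the slope), killing `Π_{C̲_K}`, hence **`toFlStarNF : Aut(𝒟^⊚) →* 𝔽_l^⋇`**
  — print's `Aut(C̲_K) → Aut(C̲_K)/Aut_ε̲(C̲_K) ⥲ 𝔽_l^⋇` as a homomorphism (surjectivity NOT claimed: instance law G-w4d065g3-1 / t8's
  `TorsionMonodromy`, the NF-kit field `exists_aut_smul`);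
* **`absStarLabel_gLabNFAutModel : label (α·q) = toFlStarNF α * label q`** — `Aut(𝒟^⊚)` acts on the `𝔽_l^⋇`-torsor `LabCusp(𝒟^⊚)`
  through `toFlStarNF` by (label-)translation; `gLabNFAutModel_eq_one_iff_toFlStarNF_eq_one` (the kernel `Aut_ε̲(𝒟^⊚)` = the
  automorphisms acting trivially on the label classes; `l ≥ 5` gives `l^⋇ ≥ 2` nonzero classes).
No instance/notation; typed ≠ proved elsewhere.
-/

noncomputable section

namespace Literature.IUT.HodgeTheaters

open CategoryTheory

universe u v w

section NFCuspLabelsAut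

variable {F : Type u} {K : Type v} {Fbar : Type w} [Field F] [NumberField F] [Field K] [NumberField K]
  [Algebra F K] [Field Fbar] [Algebra F Fbar] [Algebra K Fbar]
  {E : WeierstrassCurve F} [E.IsElliptic] {l : ℕ} {Pb : BadPlacePredicates K}
  (D : InitialThetaData F K Fbar E l Pb) (CG : D.geom.pe.CuspGalois) (hS : D.CuspClassesNormaliserStable)

namespace InitialThetaData

variable [Fact l.Prime]

/-! ### The action of `N(Π_{C̲_K})` on `LabCusp(𝒟^⊚)` as a homomorphism; descent to `Aut(𝒟^⊚)` -/

/-- The permutation action of `N(Π_{C̲_K})` on `LabCusp(𝒟^⊚)` (the maps `labActNF`, bijective with inverse `labActNF n⁻¹`).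
([IUTchI] Def 4.1 (v) p.97) [claim: Mochizuki2012, status: disputed] -/
def labActNFHom :
    ↥(Subgroup.normalizer ((D.PiCund : Subgroup D.PiC) : Set D.PiC)) →* Equiv.Perm (D.gLabPMModel CG).AbsStar where
  toFun n :=
    { toFun := D.labActNF CG hS n
      invFun := D.labActNF CG hS n⁻¹
      left_inv := fun q => by rw [← D.labActNF_mul CG hS, inv_mul_cancel, D.labActNF_one CG hS]
      right_inv := fun q => by rw [← D.labActNF_mul CG hS, mul_inv_cancel, D.labActNF_one CG hS] }
  map_one' := Equiv.ext fun q => D.labActNF_one CG hS q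
  map_mul' n m := Equiv.ext fun q => D.labActNF_mul CG hS n m q

/-- `labActNFHom n q = labActNF n q`. ([IUTchI] Def 4.1 (v) p.97) [claim: Mochizuki2012, status: disputed] -/
@[simp] theorem labActNFHom_apply (n : ↥(Subgroup.normalizer ((D.PiCund : Subgroup D.PiC) : Set D.PiC)))
    (q : (D.gLabPMModel CG).AbsStar) : D.labActNFHom CG hS n q = D.labActNF CG hS n q := rfl

/-- `Π_{C̲_K} ∩ N(Π_{C̲_K})` lies in the kernel (so the action descends to `Aut(𝒟^⊚) = N/Π_{C̲_K}`).
([IUTchI] Def 4.1 (v) p.97) [claim: Mochizuki2012, status: disputed] -/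
theorem subgroupOf_le_ker_labActNFHom :
    D.PiCund.subgroupOf (Subgroup.normalizer ((D.PiCund : Subgroup D.PiC) : Set D.PiC)) ≤ (D.labActNFHom CG hS).ker := by
  intro n hn
  rw [MonoidHom.mem_ker]
  exact Equiv.ext fun q => D.labActNF_eq_self_of_mem_PiCund CG hS n (Subgroup.mem_subgroupOf.mp hn) q

/-- **The NF-kit slot `gLabNFMap` at the model, on automorphisms: `Aut(𝒟^⊚) → Perm (LabCusp(𝒟^⊚))`** (`autEquiv⁻¹` followed by
`labActNFHom` descended modulo `Π_{C̲_K}`). ([IUTchI] Def 4.1 (v) p.97) [claim: Mochizuki2012, status: disputed] -/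
def gLabNFAutModel : Aut (D.gBaseObj) →* Equiv.Perm (D.gLabPMModel CG).AbsStar :=
  (QuotientGroup.lift _ (D.labActNFHom CG hS) (D.subgroupOf_le_ker_labActNFHom CG hS)).comp
    (OrbitCat.autEquiv D.PiCund).symm.toMonoidHom

/-- **Convention**: on `xΠ_{C̲_K} ↦ xmΠ_{C̲_K}` the label action is `(labActNFHom m)⁻¹` (`autEquiv` sends the class of `n` to
`xΠ ↦ xn⁻¹Π`; cf. t4's `gLabAutModel_autOfNormalizer`). ([IUTchI] Def 4.1 (v) p.97) [claim: Mochizuki2012, status: disputed] -/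
theorem gLabNFAutModel_autOfNormalizer (m : D.PiC)
    (hm : m ∈ Subgroup.normalizer ((D.PiCund : Subgroup D.PiC) : Set D.PiC)) :
    D.gLabNFAutModel CG hS (OrbitCat.autOfNormalizer m hm) = (D.labActNFHom CG hS ⟨m, hm⟩)⁻¹ := by
  have h1 : (OrbitCat.autOfNormalizer m hm : Aut (D.gBaseObj)) =
      OrbitCat.autEquiv D.PiCund (QuotientGroup.mk ⟨m⁻¹, Subgroup.inv_mem _ hm⟩) := by
    rw [OrbitCat.autEquiv_mk, OrbitCat.autOfNormalizerHom_apply, OrbitCat.autOfNormalizer_eq_iff]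
    simp
  have h2 : (OrbitCat.autEquiv D.PiCund).symm (OrbitCat.autOfNormalizer m hm) =
      QuotientGroup.mk ⟨m⁻¹, Subgroup.inv_mem _ hm⟩ := by
    rw [h1, MulEquiv.symm_apply_apply]
  have h3 : (⟨m⁻¹, Subgroup.inv_mem _ hm⟩ :
      ↥(Subgroup.normalizer ((D.PiCund : Subgroup D.PiC) : Set D.PiC))) = ⟨m, hm⟩⁻¹ := rfl
  change QuotientGroup.lift _ (D.labActNFHom CG hS) (D.subgroupOf_le_ker_labActNFHom CG hS)
      ((OrbitCat.autEquiv D.PiCund).symm (OrbitCat.autOfNormalizer m hm)) = _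
  rw [h2, QuotientGroup.lift_mk, h3, map_inv]

/-! ### The character `Aut(𝒟^⊚) → 𝔽_l^⋇` -/

/-- The class in `𝔽_l^⋇ = 𝔽_l^×/{±1}` of the slope of the cusp action: `N(Π_{C̲_K}) → 𝔽_l^⋇`.
([IUTchI] Ex 4.3 (i) p.99) [claim: Mochizuki2012, status: disputed] -/
def toFlStarNFOnNormalizer : ↥(Subgroup.normalizer ((D.PiCund : Subgroup D.PiC) : Set D.PiC)) →* FlStar l :=
  (QuotientGroup.mk' (unitsPlusMinus l)).comp ((D.actFSlopeHom CG hS).comp D.nfNormalizerIncl)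

/-- `toFlStarNFOnNormalizer n` is the class of `actFSlopeUnit n`. ([IUTchI] Ex 4.3 (i) p.99) [claim: Mochizuki2012, status: disputed] -/
theorem toFlStarNFOnNormalizer_apply (n : ↥(Subgroup.normalizer ((D.PiCund : Subgroup D.PiC) : Set D.PiC))) :
    D.toFlStarNFOnNormalizer CG hS n = FlStar.mk l (D.actFSlopeUnit CG hS (D.nfNormalizerIncl n)) := rfl

/-- `Π_{C̲_K} ∩ N(Π_{C̲_K})` lies in the kernel of the character (slope `±1`).
([IUTchI] Ex 4.3 (i) p.99) [claim: Mochizuki2012, status: disputed] -/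
theorem subgroupOf_le_ker_toFlStarNFOnNormalizer :
    D.PiCund.subgroupOf (Subgroup.normalizer ((D.PiCund : Subgroup D.PiC) : Set D.PiC)) ≤
      (D.toFlStarNFOnNormalizer CG hS).ker := by
  intro n hn
  rw [MonoidHom.mem_ker, toFlStarNFOnNormalizer_apply]
  exact D.flStar_mk_actFSlopeUnit_eq_one_of_mem_PiCund CG hS n (Subgroup.mem_subgroupOf.mp hn)

/-- **The character `Aut(𝒟^⊚) → 𝔽_l^⋇`** (print: `Aut(C̲_K) ↠ Aut(C̲_K)/Aut_ε̲(C̲_K) ⥲ 𝔽_l^⋇`, Ex 4.3 (i); here a homomorphism —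
surjectivity is the instance law of the NF-kit field `exists_aut_smul`, not claimed), descended through `autEquiv`.
([IUTchI] Ex 4.3 (i) p.99) [claim: Mochizuki2012, status: disputed] -/
def toFlStarNF : Aut (D.gBaseObj) →* FlStar l :=
  (QuotientGroup.lift _ (D.toFlStarNFOnNormalizer CG hS) (D.subgroupOf_le_ker_toFlStarNFOnNormalizer CG hS)).comp
    (OrbitCat.autEquiv D.PiCund).symm.toMonoidHom

/-- **Convention**: `toFlStarNF (xΠ ↦ xmΠ) = (class of the slope of m)⁻¹`. ([IUTchI] Ex 4.3 (i) p.99) [claim: Mochizuki2012, status: disputed] -/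
theorem toFlStarNF_autOfNormalizer (m : D.PiC)
    (hm : m ∈ Subgroup.normalizer ((D.PiCund : Subgroup D.PiC) : Set D.PiC)) :
    D.toFlStarNF CG hS (OrbitCat.autOfNormalizer m hm) =
      (FlStar.mk l (D.actFSlopeUnit CG hS (D.nfNormalizerIncl ⟨m, hm⟩)))⁻¹ := by
  have h1 : (OrbitCat.autOfNormalizer m hm : Aut (D.gBaseObj)) =
      OrbitCat.autEquiv D.PiCund (QuotientGroup.mk ⟨m⁻¹, Subgroup.inv_mem _ hm⟩) := by
    rw [OrbitCat.autEquiv_mk, OrbitCat.autOfNormalizerHom_apply, OrbitCat.autOfNormalizer_eq_iff]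
    simp
  have h2 : (OrbitCat.autEquiv D.PiCund).symm (OrbitCat.autOfNormalizer m hm) =
      QuotientGroup.mk ⟨m⁻¹, Subgroup.inv_mem _ hm⟩ := by
    rw [h1, MulEquiv.symm_apply_apply]
  have h3 : (⟨m⁻¹, Subgroup.inv_mem _ hm⟩ :
      ↥(Subgroup.normalizer ((D.PiCund : Subgroup D.PiC) : Set D.PiC))) = ⟨m, hm⟩⁻¹ := rfl
  change QuotientGroup.lift _ (D.toFlStarNFOnNormalizer CG hS) (D.subgroupOf_le_ker_toFlStarNFOnNormalizer CG hS)
      ((OrbitCat.autEquiv D.PiCund).symm (OrbitCat.autOfNormalizer m hm)) = _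
  rw [h2, QuotientGroup.lift_mk, h3, map_inv, toFlStarNFOnNormalizer_apply]

/-! ### `Aut(𝒟^⊚)` acts on the `𝔽_l^⋇`-torsor `LabCusp(𝒟^⊚)` through the character -/

/-- On `N(Π_{C̲_K})`: `label ((labActNFHom n)⁻¹ q) = (class of slope n)⁻¹ * label q`.
([IUTchI] Ex 4.3 (i) p.99) [claim: Mochizuki2012, status: disputed] -/
theorem absStarLabel_labActNFHom_inv (n : ↥(Subgroup.normalizer ((D.PiCund : Subgroup D.PiC) : Set D.PiC)))
    (q : (D.gLabPMModel CG).AbsStar) :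
    (D.gLabPMModel CG).absStarLabel ((D.labActNFHom CG hS n)⁻¹ q) =
      (FlStar.mk l (D.actFSlopeUnit CG hS (D.nfNormalizerIncl n)))⁻¹ * (D.gLabPMModel CG).absStarLabel q := by
  have h := D.absStarLabel_labActNF CG hS n ((D.labActNFHom CG hS n)⁻¹ q)
  rw [← labActNFHom_apply, ← Equiv.Perm.mul_apply, mul_inv_cancel, Equiv.Perm.one_apply] at h
  rw [h, ← mul_assoc, inv_mul_cancel, one_mul]

/-- **`Aut(𝒟^⊚)` acts on `LabCusp(𝒟^⊚)` through `𝔽_l^⋇`**: `label (gLabNFAutModel α q) = toFlStarNF α * label q` — the automorphism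
group acts on the label classes of cusps by translation through the character (Ex 4.3 (i): the quotient `Aut(C̲_K)/Aut_ε̲(C̲_K)` IS
`𝔽_l^⋇`, acting simply transitively on `LabCusp`). ([IUTchI] Ex 4.3 (i) p.99) [claim: Mochizuki2012, status: disputed] -/
theorem absStarLabel_gLabNFAutModel (α : Aut (D.gBaseObj)) (q : (D.gLabPMModel CG).AbsStar) :
    (D.gLabPMModel CG).absStarLabel (D.gLabNFAutModel CG hS α q) = D.toFlStarNF CG hS α * (D.gLabPMModel CG).absStarLabel q := by
  obtain ⟨m, hm, rfl⟩ := OrbitCat.exists_eq_autOfNormalizer α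
  rw [D.gLabNFAutModel_autOfNormalizer CG hS, D.toFlStarNF_autOfNormalizer CG hS]
  exact D.absStarLabel_labActNFHom_inv CG hS ⟨m, hm⟩ q

/-- An automorphism with trivial character acts trivially on `LabCusp(𝒟^⊚)` (labels are a complete invariant: `absStarEquiv`).
([IUTchI] Ex 4.3 (i) p.99) [claim: Mochizuki2012, status: disputed] -/
theorem gLabNFAutModel_eq_one_of_toFlStarNF_eq_one {α : Aut (D.gBaseObj)} (h : D.toFlStarNF CG hS α = 1) :
    D.gLabNFAutModel CG hS α = 1 := by
  ext q
  apply (D.gLabPMModel CG).absStarLabel_injective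
  rw [D.absStarLabel_gLabNFAutModel CG hS, h, one_mul, Equiv.Perm.one_apply]

/-- `LabCusp(𝒟^⊚)` is nonempty (it is in bijection with `𝔽_l^⋇`). ([IUTchI] Def 4.1 (v) p.97) [claim: Mochizuki2012, status: disputed] -/
theorem nonempty_absStar : Nonempty (D.gLabPMModel CG).AbsStar :=
  ⟨(D.gLabPMModel CG).absStarEquiv.symm 1⟩

/-- Conversely an automorphism acting trivially on `LabCusp(𝒟^⊚)` has trivial character; so **`Ker(toFlStarNF) = Aut_ε̲(𝒟^⊚)`-type
subgroup = the automorphisms fixing every label class of cusps** (Ex 4.3 (i): `Aut_ε̲(C̲_K)` «fix the cusp `ε̲`»; on the torsor,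
fixing one nonzero class = fixing all). ([IUTchI] Ex 4.3 (i) p.99) [claim: Mochizuki2012, status: disputed] -/
theorem gLabNFAutModel_eq_one_iff_toFlStarNF_eq_one (α : Aut (D.gBaseObj)) :
    D.gLabNFAutModel CG hS α = 1 ↔ D.toFlStarNF CG hS α = 1 := by
  refine ⟨fun h => ?_, D.gLabNFAutModel_eq_one_of_toFlStarNF_eq_one CG hS⟩
  obtain ⟨q⟩ := D.nonempty_absStar CG
  have h1 := D.absStarLabel_gLabNFAutModel CG hS α q
  rw [h, Equiv.Perm.one_apply] at h1
  exact (mul_eq_right.mp h1.symm)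

end InitialThetaData

end NFCuspLabelsAut

end Literature.IUT.HodgeTheaters
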